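import Summits.QuantumFields.YangMills.Theorems.IR.Negative.BlockedActivityCentralFlip

/-!
# Crux `IR` (stmt-QuantumFields-19354), lane B currency: `BlockedActivityOnsetAt` is FALSE as typed for every representation with a
# non-trivial central character — in particular for `SU(N)` fundamental, every `N ≥ 2` (located objection O-112; Negative∕ lane, `--supports` only)

PROVENANCE.  Mechanism, §1–§3 skeleton and the `SU(2)`, `ρ(z) = −𝟙` case: crux-triage seat 1 (`ym-ctriage-19354-1` g16, desk bytes
`checks-rev16/BlockedActivityOnsetFalse.lean`, sha16 `4c97a1a34b5854c1`, O-112).  This filing (refuter `ym-19354-disprove-1` g9, the single writer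
of `Theorems/IR/Negative/` for this crux, owner R103 (c)) generalises the flip from `ρ(z) = −𝟙` to an ARBITRARY central scalar `ρ(z) = c·𝟙`,
`c ≠ 1` (phase trick below), so that the physically relevant `SU(3)` and every `SU(N)`, `N ≥ 2`, fundamental, are covered unconditionally.

WHAT IS REFUTED.  `Theorems/IR/BlockedActivityDefs` (p527934) types lane B's construction statement
`BlockedActivityOnsetSC := ∀ simply connected compact simple G, ∀ r : LatticeRep G, BlockedActivityOnsetAt r.ρ`.  The structure
`BlockedRep ρ β w Y a` represents the kernel expectation of EVERY centre observable under EVERY exterior datum `σ` through ONE σ-independent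
reference `(Ω, μ, obs)`; p528785's `BlockedRep.norm_integral_sub_ref_le` bounds `|E_σ f − ∫ obs f dμ| ≤ D(a) := 2e·a·2⁸¹(2e)⁸²` for every `σ`.

* (toolkit module `Negative/BlockedActivityCentralFlip`, §1–§2) `abs_integral_plaquetteObs_le_of_blockedRep` — for a central `z` with
  `ρ z = c·𝟙`: `‖1 − c‖ · |E_σ Re tr ρ(U_{p₀})| ≤ 4 D(a) N` for EVERY `σ` (corner plaquette `p₀` of the centre cell of the standard mesh-`b` frame);
* (this module, §3–§4) `false_of_blockedActivityClass_tail` — no tail `∀ β ≥ β₂, ∃ b ≥ 1, BlockedActivityClass r.ρ β b 1 a` survives once `16 D(a) ≤ ‖1 − c‖`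
  (this is the common core of the plain and of the NT-calibrated onset statements);
* `not_blockedActivityOnsetAt_of_central` — `¬ BlockedActivityOnsetAt r.ρ` for every compact `G`, `r`, central `z`, `r.ρ z = c·𝟙`, `c ≠ 1`;
* `not_blockedActivityOnsetAt_suN` — UNCONDITIONAL: `SU(N)` fundamental, every `N ≥ 2` (`z = e^{2πi/N}·𝟙`); `not_blockedActivityOnsetAt_su2`;
* `not_blockedActivityOnsetSC_of_sc : SimplyConnectedSpace SU(2) → ¬ BlockedActivityOnsetSC` (the compact-simple-Lie input is the tree's
  `isSimpleCompactGroup_specialUnitaryGroup_holds`; the simply-connected input is DISCHARGED in the companion module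
  `Negative/BlockedActivityOnsetFalseSC` by the tree's `simplyConnectedSpace_su2`, kept apart for Theses-cone hygiene);
* `not_calibratedTail_of_central` — the conclusion of the NT-calibrated statement `BlockedActivityOnsetCalSC` (`Theorems/IR/BlockedActivityOnsetCal`)
  fails at every `(G, r, z, c)` as above and EVERY unit map `a` (the companion module turns this into
  `(∃ NT unit with LowerBounds on SU(2)) → ¬ BlockedActivityOnsetCalSC`).

Mechanism (tree facts only).  The point gauge transformation with `g(0) = z`, `g = 1` elsewhere (`flip z`) multiplies the cell-`0` link `U(0,1)`
by `z` and fixes the three other links of the corner plaquette `p₀ = (−e₀; 0,1)`, which lie OUTSIDE the cell region `Λ = cellEdges w 0` and are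
frozen to `σ` under `γ_Λ(·|σ)` (`integral_ymSpecification`); the kernels are gauge covariant (`ymSpecification_map_gaugeTransformZd_holds`).
For a phase `u`, `‖u‖ ≤ 1`, the centre observable `f_u(U) = (1 + Re(u · tr ρ(σ₁ U(0,1) σ₂⁻¹ σ₃⁻¹))/N)/2` satisfies `f_u ∘ flip z = f_{uc}`, hence
`E_{flip σ} f_u = E_σ f_{uc}`; the σ-uniform representation bounds BOTH `E_σ f_u` and `E_{flip σ} f_u` against the SAME reference value, so
`|E_σ f_u − E_σ f_{uc}| ≤ 2D(a)`, i.e. `|Re(u(1−c) · E_σ tr ρ(U_{p₀}))| ≤ 4 D(a) N`; the FIXED phase `u = conj(1−c)/‖1−c‖` makes `u(1−c) = ‖1−c‖`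
real and yields `‖1−c‖ · |E_σ Re tr ρ(U_{p₀})| ≤ 4 D(a) N` for EVERY `σ`.  The torus DLR equation (`integral_torusLift_eq_integral_ymSpecification`)
transports this to `⟨Re tr U_{p₀}⟩_{2b+1,β} ≤ N/4` once `16 D(a) ≤ ‖1−c‖`, and the weak-coupling plaquette moments
`⟨N − Re tr U_q⟩_{2L+1,β} ≤ K(1+log β)/β` (`AfOnset.exists_plaquetteCost_moments_le`, uniform in the odd torus) are contradicted at
`β = max(β₂, 1, 16K²+1)` — the onset statements offer every radius `a > 0` and let us choose `β` before they choose `b`.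

CLASS (refuter's reading): MISSTATED — the intended currency lets the reference data depend on the exterior datum through the window collar
(the flip changes `σ` on the collar edges `(−eᵢ, i)`; the repaired W-currency `BlockedActivityOnsetAtW`, p536391, excludes it, and
`univShellCond_of_blockedActivity` survives verbatim there).  The W-currency at `Y = {0}` is NOT touched by this file.
HONEST FRAMING: a negative lemma on ONE typed supplier currency of ONE open stub of a CONDITIONAL reduction; it refutes no registered stub of
the slot «sharp merge I♯_SC» (sha16 28967a1bf60ad397), proves no gap and nothing about Clay.  Sorry-free; axioms `propext`, `Classical.choice`,
`Quot.sound`.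
-/

set_option autoImplicit false

noncomputable section

open MeasureTheory
open Literature.MathematicalPhysics.QuantumFieldTheory hiding ZdEdge
open Literature.MathematicalPhysics.QuantumLattice
open Literature.Probability.LatticeModels (Site box mem_box glueWith glueWith_apply_not_mem)
open Literature.Barriers.QuantumFields (scalarCenter scalarCenter_mem_center exists_root_of_unity_ne_one)
open Summit.QuantumFields.YangMills.Cruxes.IR.Tempered (cellEdges windowCells regionEdges)

namespace Summit.QuantumFields.YangMills.Cruxes.IR.BlockedActivity

/-! ## §3 The contradiction with weak-coupling plaquette order on the odd torus -/

section Main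

variable {G : Type} [Group G] [TopologicalSpace G] [IsTopologicalGroup G] [CompactSpace G]
  [MeasurableSpace G] [BorelSpace G]

/-- **Core of O-112.**  For a compact `G`, a lattice representation `r`, a central `z` with `r.ρ z = c·𝟙`, `c ≠ 1`, and an activity
radius `a` in the smallness regime with `16 D(a) ≤ ‖1 − c‖`, NO tail `∀ β ≥ β₂, ∃ b ≥ 1, BlockedActivityClass r.ρ β b 1 a` holds:
uniform disorder of the corner plaquette contradicts weak-coupling plaquette order on the odd torus at `β = max(β₂, 1, 16K²+1)`. -/
theorem false_of_blockedActivityClass_tail (r : LatticeRep G) (hN : 1 ≤ r.N) (z : G) (hz : z ∈ Subgroup.center G)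
    (c : ℂ) (hρz : r.ρ z = c • (1 : Matrix (Fin r.N) (Fin r.N) ℂ)) (hc : c ≠ 1) {a : ℝ}
    (h1 : Real.exp 1 * a * ((81 : ℝ) + 1) ^ 2 ≤ 1 / 2) (h2 : Real.exp 1 * a * 2 ^ 81 ≤ 1) (h3 : 16 * actBound a ≤ ‖1 - c‖)
    {β₂ : ℝ} (htail : ∀ β : ℝ, β₂ ≤ β → ∃ b : ℕ, 1 ≤ b ∧ BlockedActivityClass r.ρ β b 1 a) : False := by
  haveI : SecondCountableTopology G :=
    (r.continuous.isClosedEmbedding r.injective).isEmbedding.secondCountableTopology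
  have hcpos : 0 < ‖1 - c‖ := norm_pos_iff.2 (sub_ne_zero.2 (Ne.symm hc))
  obtain ⟨K, hK0, hK⟩ := AfOnset.exists_plaquetteCost_moments_le r
  -- choose `β` first (large), then take the mesh `b` the tail offers
  set β : ℝ := max β₂ (max 1 (16 * K ^ 2 + 1)) with hβdef
  have hβ1 : 1 ≤ β := le_trans (le_max_left _ _) (le_max_right _ _)
  have hβK : 16 * K ^ 2 + 1 ≤ β := le_trans (le_max_right _ _) (le_max_right _ _)
  have hβ0 : 0 < β := one_pos.trans_le hβ1
  obtain ⟨b, hb1, hC⟩ := htail β (le_max_left _ _)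
  obtain ⟨R⟩ := hC (stdFrame b) (stdFrame_isFrame b) {0}
    (by intro c' hc'; rw [Finset.mem_singleton] at hc'; subst hc'; simp [windowCells, Fintype.mem_piFinset])
    (Finset.mem_singleton_self 0)
  set N : ℕ := r.N
  have hN' : (0 : ℝ) < (N : ℝ) := by exact_mod_cast hN
  set Λ := cellEdges (stdFrame b) 0 with hΛ
  -- (1) uniform disorder of the corner plaquette under every exterior datum: `|E_σ Re tr U_{p₀}| ≤ N/4`
  have hunif : ∀ σ : LGConfig 4 G, |∫ U, plaquetteObs r.ρ xc 0 1 U ∂(ymSpecification r.ρ β Λ σ)| ≤ (N : ℝ) / 4 := by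
    intro σ
    have h := abs_integral_plaquetteObs_le_of_blockedRep r.ρ r.continuous r.mem_unitary hN z hz c hρz hb1 R h1 h2 σ
    refine not_lt.mp fun hX => ?_
    have h3N : 16 * actBound a * N ≤ ‖1 - c‖ * N := mul_le_mul_of_nonneg_right h3 hN'.le
    have hlt := mul_lt_mul_of_pos_left hX hcpos
    linarith
  -- (2) the torus DLR equation on the odd torus of side `2b+1`: `⟨Re tr U_{p₀}⟩ = ⟨E_{torusLift ·} Re tr U_{p₀}⟩ ≤ N/4`
  obtain ⟨hΛbox, hS₀box⟩ := collar_mem_box hb1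
  have hDLR := integral_torusLift_eq_integral_ymSpecification (d := 4) r.ρ r.continuous β (L := b) Λ
    (F := plaquetteObs r.ρ xc 0 1) (continuous_plaquetteObs r.ρ r.continuous xc 0 1) (C := (N : ℝ))
    (fun U => abs_plaquetteObs_le_holds r.ρ r.mem_unitary xc 0 1 U) (S₀ := plaquetteEdges p0)
    (isCylinder_plaquetteObs r.ρ p0) hΛbox hS₀box
  haveI hPμ := isProbabilityMeasure_wilsonMeasure (d := 4) (L := 2 * b + 1) r.ρ r.continuous β
  have hRHS : ∫ U, (∫ W, plaquetteObs r.ρ xc 0 1 W ∂(ymSpecification r.ρ β Λ (torusLift (2 * b + 1) U)))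
      ∂(wilsonMeasure (d := 4) (L := 2 * b + 1) r.ρ β) ≤ (N : ℝ) / 4 := by
    have h := norm_integral_le_of_norm_le_const (μ := wilsonMeasure (d := 4) (L := 2 * b + 1) r.ρ β)
      (f := fun U => ∫ W, plaquetteObs r.ρ xc 0 1 W ∂(ymSpecification r.ρ β Λ (torusLift (2 * b + 1) U)))
      (C := (N : ℝ) / 4) (ae_of_all _ fun U => by simpa [Real.norm_eq_abs] using hunif (torusLift (2 * b + 1) U))
    exact (le_abs_self _).trans (by simpa [Real.norm_eq_abs] using h)
  -- (3) the same mean is `N − ⟨plaquetteCost⟩ ≥ N − K(1+log β)/β` by the weak-coupling moments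
  set q0 : Plaquette 4 (2 * b + 1) :=
    (Literature.Probability.LatticeModels.Torus.proj (2 * b + 1) xc, ⟨((0 : Fin 4), (1 : Fin 4)), by decide⟩) with hq0
  have hcost : (fun V : GaugeConfig 4 (2 * b + 1) G => plaquetteObs r.ρ xc 0 1 (torusLift (2 * b + 1) V)) =
      fun V => (N : ℝ) - plaquetteCost r.ρ V q0 := by
    funext V
    simp only [plaquetteCost, hq0, plaquetteObs, plaquetteHolonomy_torusProj]
    ring
  have hFi : Integrable (fun V : GaugeConfig 4 (2 * b + 1) G => plaquetteObs r.ρ xc 0 1 (torusLift (2 * b + 1) V))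
      (wilsonMeasure (d := 4) (L := 2 * b + 1) r.ρ β) :=
    integrable_of_bound
      (((continuous_plaquetteObs r.ρ r.continuous xc 0 1).comp (continuous_torusLift _)).measurable.aestronglyMeasurable)
      (fun V => abs_plaquetteObs_le_holds r.ρ r.mem_unitary xc 0 1 _)
  have hci : Integrable (fun V : GaugeConfig 4 (2 * b + 1) G => plaquetteCost r.ρ V q0)
      (wilsonMeasure (d := 4) (L := 2 * b + 1) r.ρ β) := by
    have : (fun V : GaugeConfig 4 (2 * b + 1) G => plaquetteCost r.ρ V q0) =
        fun V => (N : ℝ) - plaquetteObs r.ρ xc 0 1 (torusLift (2 * b + 1) V) := by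
      funext V; rw [congr_fun hcost V]; ring
    exact this ▸ (integrable_const _).sub hFi
  have hLHS : ∫ V, plaquetteObs r.ρ xc 0 1 (torusLift (2 * b + 1) V) ∂(wilsonMeasure (d := 4) (L := 2 * b + 1) r.ρ β) =
      (N : ℝ) - ∫ V, plaquetteCost r.ρ V q0 ∂(wilsonMeasure (d := 4) (L := 2 * b + 1) r.ρ β) := by
    rw [hcost, integral_sub (integrable_const _) hci]
    simp
  have hmom := (hK b hb1 β hβ1 q0).1
  have hineq : (N : ℝ) - K * (1 + Real.log β) / β ≤ (N : ℝ) / 4 := by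
    have := hDLR ▸ hRHS
    rw [hLHS] at this
    linarith
  -- (4) arithmetic: `3N/4 ≤ K(1+log β)/β ≤ 2K/√β` is impossible for `β ≥ 16K² + 1`, `N ≥ 1`
  have hlog := AfOnset.one_add_log_sq_le hβ1
  have h3' : 3 * (N : ℝ) / 4 * β ≤ K * (1 + Real.log β) := by
    have h' : 3 * (N : ℝ) / 4 ≤ K * (1 + Real.log β) / β := by linarith
    rwa [le_div_iff₀ hβ0] at h'
  have hN1 : (1 : ℝ) ≤ N := by exact_mod_cast hN
  have h4 : (3 * (N : ℝ) / 4 * β) ^ 2 ≤ (K * (1 + Real.log β)) ^ 2 := pow_le_pow_left₀ (by positivity) h3' 2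
  have h5 : (K * (1 + Real.log β)) ^ 2 ≤ K ^ 2 * (4 * β) := by
    rw [mul_pow]; exact mul_le_mul_of_nonneg_left hlog (sq_nonneg K)
  have h6 : (3 * (N : ℝ) / 4) ^ 2 * β * β ≤ 4 * K ^ 2 * β := by
    have e1 : (3 * (N : ℝ) / 4 * β) ^ 2 = (3 * (N : ℝ) / 4) ^ 2 * β * β := by ring
    have e2 : K ^ 2 * (4 * β) = 4 * K ^ 2 * β := by ring
    rw [e1] at h4; rw [e2] at h5
    exact h4.trans h5
  have h7 : (3 * (N : ℝ) / 4) ^ 2 * β ≤ 4 * K ^ 2 := le_of_mul_le_mul_right h6 hβ0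
  have h8 : (3 * (1 : ℝ) / 4) ^ 2 * β ≤ (3 * (N : ℝ) / 4) ^ 2 * β :=
    mul_le_mul_of_nonneg_right (pow_le_pow_left₀ (by norm_num) (by linarith) 2) hβ0.le
  nlinarith [h7, h8, hβK, sq_nonneg K]

/-- **O-112.**  For a compact group `G`, a lattice representation `r` and a central `z` with `r.ρ z = c·𝟙`, `c ≠ 1`, the blocked-activity
onset statement `BlockedActivityOnsetAt r.ρ` of lane B is false (take the radius `a = radius (‖1 − c‖/8)`, where `16 D(a) ≤ ‖1 − c‖`). -/
theorem not_blockedActivityOnsetAt_of_central (r : LatticeRep G) (hN : 1 ≤ r.N) (z : G) (hz : z ∈ Subgroup.center G)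
    (c : ℂ) (hρz : r.ρ z = c • (1 : Matrix (Fin r.N) (Fin r.N) ℂ)) (hc : c ≠ 1) : ¬ BlockedActivityOnsetAt r.ρ := by
  intro h
  have hcpos : 0 < ‖1 - c‖ := norm_pos_iff.2 (sub_ne_zero.2 (Ne.symm hc))
  have hc1 : ‖c‖ ≤ 1 := norm_le_one_of_smul_one_mem_unitary hN (hρz ▸ r.mem_unitary z)
  have hε1 : ‖1 - c‖ / 8 ≤ 1 := by
    have : ‖(1 : ℂ) - c‖ ≤ ‖(1 : ℂ)‖ + ‖c‖ := norm_sub_le _ _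
    rw [norm_one] at this
    linarith
  obtain ⟨hs1, hs2, hs3⟩ := smallness_radius (ε := ‖1 - c‖ / 8) hε1
  obtain ⟨β₂, hβ₂⟩ := h (radius (‖1 - c‖ / 8)) (radius_pos (div_pos hcpos (by norm_num)))
  exact false_of_blockedActivityClass_tail r hN z hz c hρz hc hs1 hs2 (by unfold actBound; linarith) hβ₂

/-- **O-112, calibrated form.**  At the same `(G, r, z, c)` the CONCLUSION of the NT-calibrated onset statement
(`Theorems/IR/BlockedActivityOnsetCal.BlockedActivityOnsetCalSC`: `∀ act > 0, ∃ T β₂, ∀ β ≥ β₂, ∃ b ≥ 1, a β · b < T ∧ BlockedActivityClass r.ρ β b 1 act`)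
fails for EVERY unit map `a` — the calibration `a β · b < T` is never used by the flip. -/
theorem not_calibratedTail_of_central (r : LatticeRep G) (hN : 1 ≤ r.N) (z : G) (hz : z ∈ Subgroup.center G)
    (c : ℂ) (hρz : r.ρ z = c • (1 : Matrix (Fin r.N) (Fin r.N) ℂ)) (hc : c ≠ 1) (a : ℝ → ℝ) :
    ¬ (∀ act : ℝ, 0 < act → ∃ T β₂ : ℝ, ∀ β : ℝ, β₂ ≤ β → ∃ b : ℕ, 1 ≤ b ∧ a β * (b : ℝ) < T ∧
      BlockedActivityClass r.ρ β b 1 act) := by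
  intro h
  have hcpos : 0 < ‖1 - c‖ := norm_pos_iff.2 (sub_ne_zero.2 (Ne.symm hc))
  have hc1 : ‖c‖ ≤ 1 := norm_le_one_of_smul_one_mem_unitary hN (hρz ▸ r.mem_unitary z)
  have hε1 : ‖1 - c‖ / 8 ≤ 1 := by
    have : ‖(1 : ℂ) - c‖ ≤ ‖(1 : ℂ)‖ + ‖c‖ := norm_sub_le _ _
    rw [norm_one] at this
    linarith
  obtain ⟨hs1, hs2, hs3⟩ := smallness_radius (ε := ‖1 - c‖ / 8) hε1
  obtain ⟨T, β₂, hβ₂⟩ := h (radius (‖1 - c‖ / 8)) (radius_pos (div_pos hcpos (by norm_num)))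
  exact false_of_blockedActivityClass_tail r hN z hz c hρz hc hs1 hs2 (by unfold actBound; linarith)
    (fun β hβ => by obtain ⟨b, hb, -, hC⟩ := hβ₂ β hβ; exact ⟨b, hb, hC⟩)

end Main

/-! ## §4 Instances: `SU(N)` fundamental, every `N ≥ 2` (unconditional); `SU(2)`; the corollary for `BlockedActivityOnsetSC` -/

/-- **O-112 for `SU(N)`, fundamental representation, every `N ≥ 2` (UNCONDITIONAL)**: the centre element `z = ω·𝟙`, `ω = e^{2πi/N} ≠ 1`
(`Literature.Barriers.QuantumFields.scalarCenter`), acts by the scalar `ω` in the fundamental representation. -/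
theorem not_blockedActivityOnsetAt_suN {N : ℕ} (hN : 2 ≤ N) : ¬ BlockedActivityOnsetAt (fundamentalLatticeRep N).ρ := by
  obtain ⟨ω, hω, hne⟩ := exists_root_of_unity_ne_one N hN
  exact not_blockedActivityOnsetAt_of_central (fundamentalLatticeRep N) (by rw [fundamentalLatticeRep_N]; omega)
    (scalarCenter N ω hω (by omega)) (scalarCenter_mem_center N ω hω (by omega)) ω rfl hne

/-- **O-112, calibrated tail, for `SU(N)` fundamental, every `N ≥ 2`, EVERY unit map `a` (UNCONDITIONAL)**: the conclusion of
`BlockedActivityOnsetCalSC` fails at `(SU(N), fundamental)` whatever the calibration. -/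
theorem not_calibratedTail_suN {N : ℕ} (hN : 2 ≤ N) (a : ℝ → ℝ) :
    ¬ (∀ act : ℝ, 0 < act → ∃ T β₂ : ℝ, ∀ β : ℝ, β₂ ≤ β → ∃ b : ℕ, 1 ≤ b ∧ a β * (b : ℝ) < T ∧
      BlockedActivityClass (fundamentalLatticeRep N).ρ β b 1 act) := by
  obtain ⟨ω, hω, hne⟩ := exists_root_of_unity_ne_one N hN
  exact not_calibratedTail_of_central (fundamentalLatticeRep N) (by rw [fundamentalLatticeRep_N]; omega)
    (scalarCenter N ω hω (by omega)) (scalarCenter_mem_center N ω hω (by omega)) ω rfl hne a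

/-- **O-112 at `SU(2)` (unconditional):** the blocked-activity onset fails for the fundamental representation of `SU(2)` (`z = −𝟙`). -/
theorem not_blockedActivityOnsetAt_su2 : ¬ BlockedActivityOnsetAt (fundamentalLatticeRep 2).ρ :=
  not_blockedActivityOnsetAt_suN le_rfl

/-- **Lane B's construction statement `BlockedActivityOnsetSC` is false modulo `SimplyConnectedSpace SU(2)`** — a THEOREM of the tree
(`Theorems.BrascampLiebVacuumSC.Negative.simplyConnectedSpace_su2`), discharged in the companion module `Negative/BlockedActivityOnsetFalseSC`;
the compact-simple-Lie input is the tree's `isSimpleCompactGroup_specialUnitaryGroup_holds`. -/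
theorem not_blockedActivityOnsetSC_of_sc (hsc : SimplyConnectedSpace (Matrix.specialUnitaryGroup (Fin 2) ℂ)) :
    ¬ BlockedActivityOnsetSC := fun h =>
  not_blockedActivityOnsetAt_su2 (h (Matrix.specialUnitaryGroup (Fin 2) ℂ)
    (isCompactSimpleLieGroup_specialUnitaryGroup isSimpleCompactGroup_specialUnitaryGroup_holds le_rfl) hsc
    (fundamentalLatticeRep 2))

/-- The same at any `SU(N)`, `N ≥ 2`: `SimplyConnectedSpace SU(N) → ¬ BlockedActivityOnsetSC`. -/
theorem not_blockedActivityOnsetSC_of_sc_suN {N : ℕ} (hN : 2 ≤ N)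
    (hsc : SimplyConnectedSpace (Matrix.specialUnitaryGroup (Fin N) ℂ)) : ¬ BlockedActivityOnsetSC := fun h =>
  not_blockedActivityOnsetAt_suN hN (h (Matrix.specialUnitaryGroup (Fin N) ℂ)
    (isCompactSimpleLieGroup_specialUnitaryGroup isSimpleCompactGroup_specialUnitaryGroup_holds hN) hsc
    (fundamentalLatticeRep N))

end Summit.QuantumFields.YangMills.Cruxes.IR.BlockedActivity

end
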